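import Literature.Probability.RandomPlanarGeometry.SAWHalfSpacePatternRatio
import Literature.Probability.RandomPlanarGeometry.SAWKestenRateEngines
import Literature.Probability.RandomPlanarGeometry.SAWHalfSpaceRatioOneStep
import Mathlib.Analysis.SpecialFunctions.Pow.Real
import HarnessLib

/-!
# A Kesten-type RATE for half-space walks: `−K N^{−1/3} ≤ h_{N+2}/h_N − μ² ≤ K N^{−1/4}`
# (every `ℤ^{d+2}`, unconditionally)

Topic `Literature/Probability/RandomPlanarGeometry`, on top of `SAWHalfSpacePatternRatio.lean` (Kesten's
inequality (7.3.4) for `φ_N = h_{N+2}/h_N`, `Zd.MadrasSlade1993_thm732_halfSpace`), `SAWHalfSpaceConcat.lean`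
(`Zd.bridgeCount_mul_halfSpaceCount_le : b_m h_n ≤ h_{m+n}`), `SAWKestenRateEngines.lean` (the generalised
routines `Zd.upper_rate_core_env`, `Zd.lower_rate_core_mixed`), `SAWBridgeTwoStepRate.lean` (the bridge twin
`Zd.bridgeTwoStepRate`) and `SAWHalfSpaceRatioOneStep.lean` (`Zd.LSW2004_eqA3_of_eqA2`: (A.3) from (A.2) and the
renewal inequality, the appendix's argument).

Sources. N. Madras, G. Slade (1993), §7.5 Notes (book p. 256), eq. (7.5.2) (Kesten 1963): "`−K N^{−1/3} ≤
c_{N+2}(0,x)/c_N(0,x) − μ² ≤ K N^{−1/4}`" — printed for `c_N` (7.5.1) and `c_N(0,x)` (7.5.2) only; Lawler–Schramm–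
Werner (2004), Appendix, (A.2) `h_{n+2}/h_n → μ²`, qualitative. What is proved here (lane pcv-sawmu, planner route
R27, item R27.3♯; not in print): with `a = h`, `b₀ = b` and the envelopes `e^{-c√n} μ^n ≤ b_n ≤ h_n ≤ e^{π√(n/3)} b_n
≤ e^{π√n} μ^n`, **there are `K`, `N₀` with `−K N^{−1/3} ≤ h_{N+2}/h_N − μ² ≤ K N^{−1/4}` for all `N ≥ N₀`** — the
shape of `Zd.bridgeTwoStepRate` (Kesten's (7.5.2) exponents) for half-space walks. AXIOMS: standard.

## Contents (namespace `Literature.Probability.RandomPlanarGeometry.SAW.Zd`), all PROVED, no definitions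
* `halfSpace_kesten_additive` — `∃ D ≥ 1, N₁: φ_n − D/n ≤ φ_{n+2}` (`n ≥ N₁`), `φ_n = h_{n+2}/h_n`;
* **`halfSpaceTwoStepRate`** — `∃ K N₀, ∀ N ≥ N₀: −K N^{−1/3} ≤ h_{N+2}/h_N − μ² ≤ K N^{−1/4}`;
* **`LawlerSchrammWerner2004_eqA3`** — `h_{N+1}/h_N → μ` unconditionally (lit-1's `Zd.LSW2004_eqA3_of_eqA2` + the
  tree's (A.2) and renewal inequality).
-/

noncomputable section

open Filter Topology Finset Literature.Probability.LatticeModels Literature.Probability.Percolation SimpleGraph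
open scoped BigOperators

namespace Literature.Probability.RandomPlanarGeometry.SAW.Zd

/-! ### The rate for half-space walks -/

section HalfSpace

variable (d : ℕ)

/-- The half-space data in Kesten's form: `∃ D ≥ 1, N₁` with `φ_n - D/n ≤ φ_{n+2}` for `n ≥ N₁`,
`φ_n = h_{n+2}/h_n` (from `MadrasSlade1993_thm732_halfSpace` and `φ_n ≥ 1`). [cite: MadrasSlade1993, Theorem 7.3.2 (proof); LawlerSchrammWerner2004SAW, Appendix, eq. (A.2)] -/
theorem halfSpace_kesten_additive : ∃ D : ℝ, 1 ≤ D ∧ ∃ N₁ : ℕ, ∀ n : ℕ, N₁ ≤ n →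
    (halfSpaceCount (d + 2) (n + 2) : ℝ) / halfSpaceCount (d + 2) n - D / n ≤
      (halfSpaceCount (d + 2) (n + 4) : ℝ) / halfSpaceCount (d + 2) (n + 2) := by
  obtain ⟨D, hD⟩ := MadrasSlade1993_thm732_halfSpace d
  obtain ⟨N₁, hN₁⟩ := eventually_atTop.1 hD
  refine ⟨max D 1, le_max_right _ _, max N₁ 1, fun n hn => ?_⟩
  have hn1 : 1 ≤ n := le_trans (le_max_right _ _) hn
  have h := hN₁ n (le_trans (le_max_left _ _) hn)
  have hb0 : ∀ m, (0 : ℝ) < halfSpaceCount (d + 2) m := fun m => by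
    exact_mod_cast one_le_halfSpaceCount (d := d + 2) m
  obtain ⟨φ, hφ⟩ : ∃ φ : ℝ, φ = (halfSpaceCount (d + 2) (n + 2) : ℝ) / halfSpaceCount (d + 2) n := ⟨_, rfl⟩
  obtain ⟨φ', hφ'⟩ : ∃ φ' : ℝ,
      φ' = (halfSpaceCount (d + 2) (n + 4) : ℝ) / halfSpaceCount (d + 2) (n + 2) := ⟨_, rfl⟩
  rw [← hφ, ← hφ'] at h ⊢
  have hφ1 : 1 ≤ φ := by
    rw [hφ, le_div_iff₀ (hb0 n), one_mul]; exact_mod_cast halfSpaceCount_le_add_two (d' := d + 2) n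
  have hn' : (0 : ℝ) < n := by exact_mod_cast hn1
  have h1 : φ * (φ - φ') ≤ D / n := by nlinarith
  have h2 : φ - φ' ≤ max D 1 / n := by
    by_cases hcase : φ - φ' ≤ 0
    · exact hcase.trans (by positivity)
    · rw [not_le] at hcase
      have : φ - φ' ≤ φ * (φ - φ') := by nlinarith
      calc φ - φ' ≤ D / n := this.trans h1
        _ ≤ max D 1 / n := div_le_div_of_nonneg_right (le_max_left _ _) hn'.le
  linarith

/-- **A Kesten-type RATE for (A.2), every dimension `d + 2 ≥ 2`**: there are `K` and `N₀` with
`-K N^{-1/3} ≤ h_{N+2}/h_N - μ² ≤ K N^{-1/4}` for all `N ≥ N₀` (the asymmetric exponents of Kesten's (7.5.2), for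
half-space walks; the printed (A.2) has no rate). Upper side: the upper routine with the envelope
`h_n ≤ e^{π√n} μ^n`; deviations `u > μ²` are excluded for `N > (K_up/μ²)⁴` by the same routine at `u = μ²`. Lower
side: the mixed routine with `b_m h_n ≤ h_{m+n}` and `b_n ≥ e^{-c√n} μ^n`.
[cite: MadrasSlade1993, §7.5 eq. (7.5.2) and Lemma 7.3.1; LawlerSchrammWerner2004SAW, Appendix, eq. (A.2)] -/
theorem halfSpaceTwoStepRate : ∃ K : ℝ, ∃ N₀ : ℕ, ∀ N : ℕ, N₀ ≤ N →
    -K * (N : ℝ) ^ (-(1 : ℝ) / 3) ≤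
        (halfSpaceCount (d + 2) (N + 2) : ℝ) / halfSpaceCount (d + 2) N - connectiveConstant (d + 2) ^ 2 ∧
      (halfSpaceCount (d + 2) (N + 2) : ℝ) / halfSpaceCount (d + 2) N - connectiveConstant (d + 2) ^ 2 ≤
        K * (N : ℝ) ^ (-(1 : ℝ) / 4) := by
  obtain ⟨μ, hμdef⟩ : ∃ μ : ℝ, μ = connectiveConstant (d + 2) := ⟨_, rfl⟩
  have hμ : 0 < μ := by rw [hμdef]; exact connectiveConstant_pos (d + 2)
  have hμ1 : 1 ≤ μ := by rw [hμdef]; exact one_le_connectiveConstant (d + 2)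
  have hh : ∀ n, (0 : ℝ) < (halfSpaceCount (d + 2) n : ℝ) := fun n => by
    exact_mod_cast one_le_halfSpaceCount (d := d + 2) n
  have hbb : ∀ n, (0 : ℝ) < (bridgeCount (d + 2) n : ℝ) := fun n => by
    exact_mod_cast one_le_bridgeCount (d := d + 2) n
  obtain ⟨D, hD1, N₁, hK⟩ := halfSpace_kesten_additive d
  obtain ⟨c₀, hc₀⟩ := exp_mul_pow_le_bridgeCount (d := d + 2)
  obtain ⟨c, hcdef⟩ : ∃ c : ℝ, c = max c₀ 0 := ⟨_, rfl⟩
  have hc0 : 0 ≤ c := by rw [hcdef]; exact le_max_right _ _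
  -- lower envelope on `b` (hence on `h ≥ b`)
  have hlob : ∀ n : ℕ, Real.exp (-(c * Real.sqrt n)) * μ ^ n ≤ (bridgeCount (d + 2) n : ℝ) := by
    intro n
    rw [hμdef]
    refine le_trans (mul_le_mul_of_nonneg_right ?_ (pow_nonneg (connectiveConstant_pos (d + 2)).le n)) (hc₀ n)
    exact Real.exp_le_exp.2 (neg_le_neg (mul_le_mul_of_nonneg_right (by rw [hcdef]; exact le_max_left _ _)
      (Real.sqrt_nonneg _)))
  have hbh : ∀ n : ℕ, (bridgeCount (d + 2) n : ℝ) ≤ halfSpaceCount (d + 2) n := fun n => by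
    exact_mod_cast Finset.card_le_card (bridges_subset_halfSpaceWalks (d := d + 2) n)
  have hlo : ∀ n : ℕ, Real.exp (-(c * Real.sqrt n)) * μ ^ n ≤ (halfSpaceCount (d + 2) n : ℝ) :=
    fun n => (hlob n).trans (hbh n)
  -- upper envelope `h_n ≤ e^{π√n} μ^n`
  have hhi : ∀ n : ℕ, (halfSpaceCount (d + 2) n : ℝ) ≤ Real.exp (Real.pi * Real.sqrt n) * μ ^ n := by
    intro n
    have h1 := halfSpaceCount_le_exp_sharp_mul_bridgeCount (d := d + 2) n
    have h2 : (bridgeCount (d + 2) n : ℝ) ≤ μ ^ n := by rw [hμdef]; exact bridgeCount_le_pow (d := d + 2) n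
    have hF : Real.exp (Real.pi * Real.sqrt ((n : ℝ) / 3)) ≤ Real.exp (Real.pi * Real.sqrt n) := by
      refine Real.exp_le_exp.2 (mul_le_mul_of_nonneg_left (Real.sqrt_le_sqrt ?_) Real.pi_pos.le)
      have : (0 : ℝ) ≤ n := Nat.cast_nonneg n
      linarith
    calc (halfSpaceCount (d + 2) n : ℝ) ≤ Real.exp (Real.pi * Real.sqrt ((n : ℝ) / 3)) * bridgeCount (d + 2) n := h1
      _ ≤ Real.exp (Real.pi * Real.sqrt n) * μ ^ n := mul_le_mul hF h2 (Nat.cast_nonneg _) (by positivity)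
  -- mixed supermultiplicativity `b_m h_n ≤ h_{m+n}`
  have hmix : ∀ m n : ℕ, (bridgeCount (d + 2) m : ℝ) * (halfSpaceCount (d + 2) n : ℝ) ≤
      (halfSpaceCount (d + 2) (m + n) : ℝ) := fun m n => by
    exact_mod_cast bridgeCount_mul_halfSpaceCount_le (d := d + 2) m n
  have hone : ∀ n, (1 : ℝ) ≤ (halfSpaceCount (d + 2) (n + 2) : ℝ) / halfSpaceCount (d + 2) n := fun n => by
    rw [le_div_iff₀ (hh n), one_mul]; exact_mod_cast halfSpaceCount_le_add_two (d' := d + 2) n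
  -- constants
  obtain ⟨A, hA⟩ : ∃ A : ℝ, A = 32 * c ^ 2 * μ ^ 4 * D + 4 * D ^ 3 := ⟨_, rfl⟩
  have hA0 : 0 < A := by rw [hA]; positivity
  have hD0 : 0 < D := by linarith
  obtain ⟨c'', hc''⟩ : ∃ c'' : ℝ, c'' = c + Real.pi * Real.sqrt (1 + μ ^ 2) := ⟨_, rfl⟩
  have hc''0 : 0 ≤ c'' := by rw [hc'']; positivity
  obtain ⟨Kup, hKup⟩ : ∃ K : ℝ, K = Real.sqrt (8 * μ ^ 2 * D * (c'' + 1)) + 2 * D * (2 * c'' + 1) := ⟨_, rfl⟩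
  have hKup0 : 0 ≤ Kup := by rw [hKup]; positivity
  obtain ⟨Klo, hKlo⟩ : ∃ K : ℝ, K = A ^ ((1 : ℝ) / 3) := ⟨_, rfl⟩
  have hKlo0 : 0 ≤ Klo := by rw [hKlo]; positivity
  -- the upper routine, packaged: a deviation `0 < u ≤ μ²` at `N ≥ max(N₁,1)` gives `u N^{1/4} ≤ Kup`
  have core_up : ∀ N : ℕ, N₁ ≤ N → 1 ≤ N → ∀ u : ℝ, 0 < u → u ≤ μ ^ 2 →
      μ ^ 2 + u ≤ (halfSpaceCount (d + 2) (N + 2) : ℝ) / halfSpaceCount (d + 2) N →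
        u * (N : ℝ) ^ ((1 : ℝ) / 4) ≤ Kup := by
    intro N hN hN1 u hu huμ hdev
    rw [hKup, hc'']
    exact upper_rate_core_env (b := fun n => (halfSpaceCount (d + 2) n : ℝ)) (N₁ := N₁) hh hμ hD1 hc0
      Real.pi_pos.le hK hhi hlo hN hN1 hu huμ hdev
  refine ⟨Kup + Klo, 2 * N₁ + 2 + (Nat.ceil (A / D ^ 3) + 1) + (Nat.ceil ((Kup / μ ^ 2) ^ 4) + 1),
    fun N hN => ?_⟩
  have hNN₁ : N₁ ≤ N := by omega
  have hN1 : 1 ≤ N := by omega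
  have hNr : (1 : ℝ) ≤ N := by exact_mod_cast hN1
  have hN0 : (0 : ℝ) < N := by linarith
  obtain ⟨φ, hφ⟩ : ∃ φ : ℝ, φ = (halfSpaceCount (d + 2) (N + 2) : ℝ) / halfSpaceCount (d + 2) N := ⟨_, rfl⟩
  rw [← hφ, ← hμdef]
  have hφ1 : 1 ≤ φ := by rw [hφ]; exact hone N
  have hr3 : 0 ≤ (N : ℝ) ^ (-(1 : ℝ) / 3) := by positivity
  have hr4 : 0 ≤ (N : ℝ) ^ (-(1 : ℝ) / 4) := by positivity
  constructor
  · -- lower side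
    by_cases hupos : μ ^ 2 - φ ≤ 0
    · nlinarith
    rw [not_le] at hupos
    have core : ∀ v : ℝ, 0 < v → v ≤ μ ^ 2 - φ → v ≤ D → v ^ 3 * N ≤ A := by
      intro v hv hvu hvD
      rw [hA]
      refine lower_rate_core_mixed (b := fun n => (halfSpaceCount (d + 2) n : ℝ))
        (b₀ := fun n => (bridgeCount (d + 2) n : ℝ)) (N₁ := N₁) hh hμ hD1 hK hmix hlob
        (by omega) hv ?_ hvD ?_
      · have : φ > 0 := by linarith
        linarith
      · show (halfSpaceCount (d + 2) (N + 2) : ℝ) / halfSpaceCount (d + 2) N ≤ μ ^ 2 - v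
        rw [← hφ]; linarith
    have huD : μ ^ 2 - φ ≤ D := by
      by_contra hgt
      rw [not_le] at hgt
      have h := core D hD0 hgt.le le_rfl
      have hN' : A / D ^ 3 < N := by
        have h1 : (Nat.ceil (A / D ^ 3) : ℝ) < N := by
          have : Nat.ceil (A / D ^ 3) + 1 ≤ N := by omega
          exact_mod_cast this
        exact (Nat.le_ceil _).trans_lt h1
      rw [div_lt_iff₀ (by positivity)] at hN'
      linarith
    have hmain := core (μ ^ 2 - φ) hupos le_rfl huD
    have hKN : μ ^ 2 - φ ≤ Klo * (N : ℝ) ^ (-(1 : ℝ) / 3) := by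
      have h1 : (μ ^ 2 - φ) ^ 3 ≤ A / N := by rw [le_div_iff₀ hN0]; linarith
      have h2 : μ ^ 2 - φ = ((μ ^ 2 - φ) ^ 3) ^ ((1 : ℝ) / 3) := by
        rw [one_div, show (3 : ℝ) = ((3 : ℕ) : ℝ) by norm_num, Real.pow_rpow_inv_natCast hupos.le (by norm_num)]
      rw [h2]
      calc ((μ ^ 2 - φ) ^ 3) ^ ((1 : ℝ) / 3) ≤ (A / N) ^ ((1 : ℝ) / 3) :=
            Real.rpow_le_rpow (by positivity) h1 (by norm_num)
        _ = Klo * (N : ℝ) ^ (-(1 : ℝ) / 3) := by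
            rw [hKlo, Real.div_rpow hA0.le hN0.le, div_eq_mul_inv, ← Real.rpow_neg hN0.le]
            norm_num
    nlinarith
  · -- upper side
    by_cases hupos : φ - μ ^ 2 ≤ 0
    · nlinarith
    rw [not_le] at hupos
    have ht0 : 0 < (N : ℝ) ^ ((1 : ℝ) / 4) := Real.rpow_pos_of_pos hN0 _
    -- deviations `> μ²` are impossible at this `N`: the routine at `u = μ²` would give `N ≤ (Kup/μ²)⁴`
    have hularge : φ - μ ^ 2 ≤ μ ^ 2 := by
      by_contra hgt
      rw [not_le] at hgt
      have hdev2 : μ ^ 2 + μ ^ 2 ≤ (halfSpaceCount (d + 2) (N + 2) : ℝ) / halfSpaceCount (d + 2) N := by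
        rw [← hφ]; linarith
      have h := core_up N hNN₁ hN1 (μ ^ 2) (by positivity) le_rfl hdev2
      -- `μ² N^{1/4} ≤ Kup` ⇒ `N ≤ (Kup/μ²)^4`
      have h1 : (N : ℝ) ^ ((1 : ℝ) / 4) ≤ Kup / μ ^ 2 := by
        rw [le_div_iff₀ (by positivity)]; linarith
      have h2 : (N : ℝ) ≤ (Kup / μ ^ 2) ^ 4 := by
        have := pow_le_pow_left₀ ht0.le h1 4
        rw [← Real.rpow_natCast, ← Real.rpow_mul hN0.le] at this
        norm_num at this
        exact this
      have h3 : ((Kup / μ ^ 2) ^ 4 : ℝ) < N := by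
        have h4 : (Nat.ceil ((Kup / μ ^ 2) ^ 4) : ℝ) < N := by
          have : Nat.ceil ((Kup / μ ^ 2) ^ 4) + 1 ≤ N := by omega
          exact_mod_cast this
        exact (Nat.le_ceil _).trans_lt h4
      linarith
    have hdev : μ ^ 2 + (φ - μ ^ 2) ≤ (halfSpaceCount (d + 2) (N + 2) : ℝ) / halfSpaceCount (d + 2) N := by
      rw [← hφ]; linarith
    have hut := core_up N hNN₁ hN1 (φ - μ ^ 2) hupos hularge hdev
    have e : (N : ℝ) ^ (-(1 : ℝ) / 4) = ((N : ℝ) ^ ((1 : ℝ) / 4))⁻¹ := by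
      rw [← Real.rpow_neg hN0.le]; norm_num
    rw [e]
    rw [← le_div_iff₀ ht0, div_eq_mul_inv] at hut
    have : Kup * ((N : ℝ) ^ ((1 : ℝ) / 4))⁻¹ ≤ (Kup + Klo) * ((N : ℝ) ^ ((1 : ℝ) / 4))⁻¹ :=
      mul_le_mul_of_nonneg_right (by linarith) (inv_nonneg.2 ht0.le)
    linarith

/-- **Lawler–Schramm–Werner (A.3), unconditionally: `h_{N+1}/h_N → μ` on every `ℤ^{d+2}`** — the printed
one-step ratio limit theorem for half-space walks, by `Zd.LSW2004_eqA3_of_eqA2` (the appendix's argument, formalised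
in `SAWHalfSpaceRatioOneStep.lean`) fed with its two inputs proved in the tree: (A.2)
`Zd.LawlerSchrammWerner2004_eqA2` and the renewal inequality `Zd.sum_irreducibleBridgeCount_mul_halfSpaceCount_le`.
[cite: LawlerSchrammWerner2004SAW, Appendix, eq. (A.3); MadrasSlade1993, Theorem 7.3.2 and Lemma 7.3.1] -/
theorem LawlerSchrammWerner2004_eqA3 :
    Tendsto (fun N : ℕ => (halfSpaceCount (d + 2) (N + 1) : ℝ) / halfSpaceCount (d + 2) N) atTop
      (𝓝 (connectiveConstant (d + 2))) :=
  LSW2004_eqA3_of_eqA2 (LawlerSchrammWerner2004_eqA2 d)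
    (fun n _ => sum_irreducibleBridgeCount_mul_halfSpaceCount_le n)

end HalfSpace

end Literature.Probability.RandomPlanarGeometry.SAW.Zd

end
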